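import Literature.Computability.ImplicitComplexity.SoftTypeAssignmentParallel
import Literature.Computability.ImplicitComplexity.SoftTypeAssignmentFreeVars
import Literature.Computability.ImplicitComplexity.STASubstitution
import Literature.Computability.ImplicitComplexity.STAEncBasics
import HarnessLib

/-!
# Closed `Λ₊` terms, application spines and the `β`-behaviour of closed combinators

Untyped toolkit for programming in `STA₊` (GMR08 = Gaboardi–Marion–Ronchi Della Rocca 2008,
§3.2: data types and programs are ordinary `λ`-terms; typing is external). In de Bruijn form:

* `Term.bnd n M` (all free indices `< n`), `Term.Closed M` (decidable), and the facts that closed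
  terms are invariant under renaming and substitution;
* lemmas on the spines `Term.apps` and iterated abstractions `Term.lams` of `STAEncBasics.lean`;
* **the generic `β`-lemma** `apps_lams_betaReduces`: `(λ^q B) t₁ ⋯ t_q →β* B[t⃗]` for closed
  arguments (`Term.instN`), and its one-step head form `hd_apps_lams`;
* the standard closed combinators used by the encodings: the selectors `oneHot q i` of
  `STAEncBasics.lean` (the elements of a `q`-element data type, GMR08 §3.2 booleans for `q = 2`;
  here their `β`-behaviour on closed arguments), the pairing `PAIR = λxyk.kxy` (GMR08 §3.2 `⟨M, N⟩`), chains
  `chain K Z [v₀,…] = K v₀ (K v₁ (⋯ Z))` and Church lists `encList vs = λcz.chain c z vs`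
  (GMR08 §3.2 strings), with their `β`-specifications.

## References

* [GaboardiMarionRonchidellarocca2008] §3.2 (data types), Def. 5.2.
* H. P. Barendregt, *The Lambda Calculus*, 1984, §2.1, §6.1 (folklore combinators).
-/

namespace Literature.Computability.ImplicitComplexity

namespace STA

namespace Term

/-! ### Bounded and closed terms -/

/-- `M.bnd n`: every free de Bruijn index of `M` is `< n`. [folklore] -/
def bnd : ℕ → Term → Bool
  | n, .var i => decide (i < n)
  | n, .app M N => bnd n M && bnd n N
  | n, .lam M => bnd (n + 1) M
  | n, .sum M N => bnd n M && bnd n N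

/-- Unfolding at a variable. [folklore] -/
@[simp] theorem bnd_var (n i : ℕ) : (Term.var i).bnd n = decide (i < n) := rfl

/-- Unfolding at an application. [folklore] -/
@[simp] theorem bnd_app (n : ℕ) (M N : Term) : (Term.app M N).bnd n = (M.bnd n && N.bnd n) := rfl

/-- Unfolding at an abstraction. [folklore] -/
@[simp] theorem bnd_lam (n : ℕ) (M : Term) : (Term.lam M).bnd n = M.bnd (n + 1) := rfl

/-- Unfolding at a sum. [folklore] -/
@[simp] theorem bnd_sum (n : ℕ) (M N : Term) : (Term.sum M N).bnd n = (M.bnd n && N.bnd n) := rfl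

/-- Free variables of an `n`-bounded term are `< n`. [folklore] -/
theorem lt_of_bnd : ∀ {n : ℕ} {M : Term}, M.bnd n = true → ∀ i ∈ M.fv, i < n
  | n, .var j, h, i, hi => by
    simp only [bnd_var, decide_eq_true_eq] at h
    rw [mem_fv_var] at hi
    omega
  | n, .app M N, h, i, hi => by
    simp only [bnd_app, Bool.and_eq_true] at h
    rcases mem_fv_app.1 hi with hi | hi
    exacts [lt_of_bnd h.1 i hi, lt_of_bnd h.2 i hi]
  | n, .lam M, h, i, hi => by
    simp only [bnd_lam] at h
    have := lt_of_bnd h (i + 1) (mem_fv_lam.1 hi)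
    omega
  | n, .sum M N, h, i, hi => by
    simp only [bnd_sum, Bool.and_eq_true] at h
    rcases mem_fv_sum.1 hi with hi | hi
    exacts [lt_of_bnd h.1 i hi, lt_of_bnd h.2 i hi]

/-- Monotonicity of the bound. [folklore] -/
theorem bnd_mono : ∀ {n m : ℕ} {M : Term}, M.bnd n = true → n ≤ m → M.bnd m = true
  | n, m, .var j, h, hnm => by
    simp only [bnd_var, decide_eq_true_eq] at h ⊢; omega
  | n, m, .app M N, h, hnm => by
    simp only [bnd_app, Bool.and_eq_true] at h ⊢
    exact ⟨bnd_mono h.1 hnm, bnd_mono h.2 hnm⟩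
  | n, m, .lam M, h, hnm => by
    simp only [bnd_lam] at h ⊢
    exact bnd_mono h (by omega)
  | n, m, .sum M N, h, hnm => by
    simp only [bnd_sum, Bool.and_eq_true] at h ⊢
    exact ⟨bnd_mono h.1 hnm, bnd_mono h.2 hnm⟩

/-- Renamings agreeing below the bound act equally. [folklore] -/
theorem rename_congr_of_bnd {n : ℕ} {M : Term} (h : M.bnd n = true) {ρ ρ' : ℕ → ℕ} (hρ : ∀ i < n, ρ i = ρ' i) :
    M.rename ρ = M.rename ρ' :=
  rename_congr_fv fun i hi => hρ i (lt_of_bnd h i hi)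

/-- Substitutions agreeing below the bound act equally. [folklore] -/
theorem substp_congr_of_bnd {n : ℕ} {M : Term} (h : M.bnd n = true) {τ τ' : ℕ → Term} (hτ : ∀ i < n, τ i = τ' i) :
    M.substp τ = M.substp τ' :=
  substp_congr_fv fun i hi => hτ i (lt_of_bnd h i hi)

/-- Closed terms (no free index). Decidable, so that concrete combinators are checked by `decide`.
[folklore] -/
def Closed (M : Term) : Prop := M.bnd 0 = true

/-- Closedness is decidable. [folklore] -/
instance : DecidablePred Closed := fun M => inferInstanceAs (Decidable (M.bnd 0 = true))

namespace Closed

variable {M N : Term}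

/-- A closed term has no free variables. [folklore] -/
theorem fv_eq (h : M.Closed) : M.fv = ∅ :=
  Finset.eq_empty_of_forall_notMem fun i hi => absurd (lt_of_bnd h i hi) (Nat.not_lt_zero i)

/-- Closed terms are invariant under renaming. [folklore] -/
@[simp] theorem rename_eq (h : M.Closed) (ρ : ℕ → ℕ) : M.rename ρ = M := by
  rw [rename_congr_of_bnd h (ρ' := id) fun i hi => absurd hi (Nat.not_lt_zero i), rename_id]

/-- Closed terms are invariant under substitution. [folklore] -/
@[simp] theorem substp_eq (h : M.Closed) (τ : ℕ → Term) : M.substp τ = M := by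
  rw [substp_congr_of_bnd h (τ' := Term.var) fun i hi => absurd hi (Nat.not_lt_zero i), substp_var]

/-- Closed terms are invariant under `[N/x]`. [folklore] -/
@[simp] theorem subst0_eq (h : M.Closed) (N : Term) : M.subst0 N = M := by
  rw [subst0_eq_substp, h.substp_eq]

/-- A closed term is bounded by every `n`. [folklore] -/
theorem bnd (h : M.Closed) (n : ℕ) : M.bnd n = true := bnd_mono h (Nat.zero_le n)

end Closed

/-- Closedness of an application. [folklore] -/
@[simp] theorem closed_app {M N : Term} : (Term.app M N).Closed ↔ M.Closed ∧ N.Closed := by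
  simp [Closed]

/-- Closedness of a sum. [folklore] -/
@[simp] theorem closed_sum {M N : Term} : (Term.sum M N).Closed ↔ M.Closed ∧ N.Closed := by
  simp [Closed]

/-- Closedness of an abstraction. [folklore] -/
theorem closed_lam {M : Term} : (Term.lam M).Closed ↔ M.bnd 1 = true := Iff.rfl

/-- `0` is closed. [folklore] -/
theorem closed_zero : zero.Closed := by decide

/-- `1` is closed. [folklore] -/
theorem closed_one : one.Closed := by decide

/-- Bits are closed. [folklore] -/
theorem closed_encBit (b : Bool) : (encBit b).Closed := by cases b <;> decide

/-! ### Spines and iterated abstractions -/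

/-! `Term.apps M [N₁, …, N_k] = M N₁ ⋯ N_k` and `Term.lams q B = λ^q B` are those of `STAEncBasics.lean`
(with `apps_nil`, `apps_cons`, `apps_append`). -/

/-- A spine is closed iff all its parts are. [folklore] -/
theorem closed_apps {M : Term} {Ns : List Term} : (M.apps Ns).Closed ↔ M.Closed ∧ ∀ N ∈ Ns, N.Closed := by
  induction Ns generalizing M with
  | nil => simp
  | cons N Ns ih => simp [ih, and_assoc]

/-- The bound of a spine. [folklore] -/
theorem bnd_apps {n : ℕ} {M : Term} {Ns : List Term} (hM : M.bnd n = true) (hNs : ∀ N ∈ Ns, N.bnd n = true) :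
    (M.apps Ns).bnd n = true := by
  induction Ns generalizing M with
  | nil => exact hM
  | cons N Ns ih =>
    exact ih (by simp [hM, hNs N (by simp)]) fun N' hN' => hNs N' (by simp [hN'])

/-- No binder. [folklore] -/
@[simp] theorem lams_zero (B : Term) : lams 0 B = B := rfl

/-- One more binder. [folklore] -/
@[simp] theorem lams_succ (n : ℕ) (B : Term) : lams (n + 1) B = .lam (lams n B) := rfl

/-- The bound of an iterated abstraction. [folklore] -/
@[simp] theorem bnd_lams (n k : ℕ) (B : Term) : (lams n B).bnd k = B.bnd (k + n) := by
  induction n generalizing k with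
  | zero => rfl
  | succ n ih => simp only [lams_succ, bnd_lam, ih]; congr 1; omega

/-! ### Instantiating binders with closed terms -/

/-- The substitution replacing index `k` by `N` (indices above `k` shift down). [folklore] -/
def substAt (k : ℕ) (N : Term) (i : ℕ) : Term := if i < k then .var i else if i = k then N else .var (i - 1)

/-- `consSub N = substAt 0 N`. [folklore] -/
theorem consSub_eq_substAt (N : Term) : consSub N = substAt 0 N := by
  funext i
  cases i with
  | zero => simp [substAt]
  | succ i => simp [substAt]

/-- Below the index. [folklore] -/
@[simp] theorem substAt_lt {k i : ℕ} (N : Term) (h : i < k) : substAt k N i = .var i := by simp [substAt, h]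

/-- At the index. [folklore] -/
@[simp] theorem substAt_self (k : ℕ) (N : Term) : substAt k N k = N := by simp [substAt]

/-- Above the index. [folklore] -/
theorem substAt_gt {k i : ℕ} (N : Term) (h : k < i) : substAt k N i = .var (i - 1) := by
  simp [substAt, show ¬ i < k by omega, show i ≠ k by omega]

/-- Lifting `substAt` under a binder, for a closed substituend. [folklore] -/
theorem up_substAt {N : Term} (hN : N.Closed) (k : ℕ) : Term.up (substAt k N) = substAt (k + 1) N := by
  funext i
  cases i with
  | zero => simp [Term.up, substAt]
  | succ i =>
    rcases Nat.lt_trichotomy i k with h | rfl | h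
    · rw [substAt_lt N (show i + 1 < k + 1 by omega)]
      simp [Term.up, substAt_lt N h, Term.rename]
    · rw [substAt_self]
      simp [Term.up, hN.rename_eq]
    · rw [substAt_gt N (show k + 1 < i + 1 by omega)]
      simp only [Term.up, substAt_gt N h, Term.rename, Term.var.injEq]
      omega

/-- Iterated lifting of `substAt`. [folklore] -/
theorem iterate_up_substAt {N : Term} (hN : N.Closed) (n k : ℕ) : Term.up^[n] (substAt k N) = substAt (k + n) N := by
  induction n generalizing k with
  | zero => rfl
  | succ n ih => rw [Function.iterate_succ_apply, up_substAt hN, ih]; congr 1; omega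

/-- `(λ^n B)[N/x] = λ^n (B[N at index n])` for closed `N`. [folklore] -/
theorem lams_subst0 {N : Term} (hN : N.Closed) (n : ℕ) (B : Term) :
    (lams n B).subst0 N = lams n (B.substp (substAt n N)) := by
  rw [subst0_eq_substp, consSub_eq_substAt, substp_lams, iterate_up_substAt hN, Nat.zero_add]

/-- The simultaneous instantiation `[t₀/x₀, …, t_{q-1}/x_{q-1}]` of the binders of `λ^q`
(`x₀` outermost, i.e. de Bruijn index `q - 1` in the body). [folklore] -/
def instN (q : ℕ) (ts : List Term) (i : ℕ) : Term := if i < q then ts.getD (q - 1 - i) (.var 0) else .var (i - q)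

/-- Inside the binders. [folklore] -/
@[simp] theorem instN_lt {q i : ℕ} (ts : List Term) (h : i < q) : instN q ts i = ts.getD (q - 1 - i) (.var 0) := by
  simp [instN, h]

/-- Outside the binders. [folklore] -/
theorem instN_ge {q i : ℕ} (ts : List Term) (h : q ≤ i) : instN q ts i = .var (i - q) := by
  simp [instN, show ¬ i < q by omega]

/-- `instN 0 [] = var`. [folklore] -/
theorem instN_zero : instN 0 [] = Term.var := by
  funext i; simp [instN]

/-- One more binder: `substAt q t` followed by `instN q ts` is `instN (q+1) (t :: ts)`. [folklore] -/
theorem substAt_substp_instN {q : ℕ} {t : Term} {ts : List Term} (ht : t.Closed) (i : ℕ) :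
    (substAt q t i).substp (instN q ts) = instN (q + 1) (t :: ts) i := by
  rcases Nat.lt_trichotomy i q with h | rfl | h
  · rw [substAt_lt t h, instN_lt _ (show i < q + 1 by omega)]
    simp only [Term.substp, instN_lt ts h]
    rw [show q + 1 - 1 - i = (q - 1 - i) + 1 by omega, List.getD_cons_succ]
  · rw [substAt_self, ht.substp_eq, instN_lt _ (Nat.lt_succ_self _)]
    simp
  · rw [substAt_gt t h, instN_ge _ (show q + 1 ≤ i by omega)]
    simp only [Term.substp, instN_ge ts (show q ≤ i - 1 by omega), Term.var.injEq]
    omega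

end Term

open Term

/-! ### The generic `β`-lemmas -/

/-- `→β*` in the head of a spine. [folklore] -/
theorem BetaReduces.apps_head {M M' : Term} (h : BetaReduces M M') (as : List Term) :
    BetaReduces (M.apps as) (M'.apps as) := by
  induction as generalizing M M' with
  | nil => exact h
  | cons a as ih => exact ih (h.appL a)

/-- `→β*` in the arguments of a spine. [folklore] -/
theorem BetaReduces.apps_args (M : Term) {as bs : List Term} (h : List.Forall₂ BetaReduces as bs) :
    BetaReduces (M.apps as) (M.apps bs) := by
  induction h generalizing M with
  | nil => exact BetaReduces.rfl' _
  | cons hab _ ih => exact ((BetaReduces.appR M hab).apps_head _).trans' (ih _)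

/-- A weak head step in the head of a spine. [folklore] -/
theorem Hd.apps_head {M M' : Term} (h : Hd M M') (as : List Term) : Hd (M.apps as) (M'.apps as) := by
  induction as generalizing M M' with
  | nil => exact h
  | cons a as ih => exact ih (Hd.appL a h)

/-- A `β`-step in the head of a spine. [folklore] -/
theorem RedB.apps_head {M M' : Term} (h : RedB M M') (as : List Term) : RedB (M.apps as) (M'.apps as) := by
  induction as generalizing M M' with
  | nil => exact h
  | cons a as ih => exact ih (RedB.appL a h)

/-- **Head `β`-step of a combinator**: `(λ^{q+1} B) t a⃗ →ₕ (λ^q B[t at q]) a⃗` for closed `t`.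
[folklore] -/
theorem hd_apps_lams {t : Term} (ht : t.Closed) (q : ℕ) (B : Term) (as : List Term) :
    Hd ((lams (q + 1) B).apps (t :: as)) ((lams q (B.substp (substAt q t))).apps as) := by
  rw [lams_succ, apps_cons, ← lams_subst0 ht]
  exact (Hd.beta _ _).apps_head as

/-- The same step as a `β`-step. [folklore] -/
theorem redB_apps_lams {t : Term} (ht : t.Closed) (q : ℕ) (B : Term) (as : List Term) :
    RedB ((lams (q + 1) B).apps (t :: as)) ((lams q (B.substp (substAt q t))).apps as) := by
  rw [lams_succ, apps_cons, ← lams_subst0 ht]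
  exact (RedB.beta _ _).apps_head as

/-- **The generic `β`-lemma**: `(λ^q B) t₀ ⋯ t_{q-1} →β* B[t⃗]` for closed arguments. [folklore] -/
theorem apps_lams_betaReduces (B : Term) :
    ∀ (q : ℕ) (ts : List Term), ts.length = q → (∀ t ∈ ts, t.Closed) →
      BetaReduces ((lams q B).apps ts) (B.substp (instN q ts))
  | 0, [], _, _ => by rw [instN_zero, substp_var]; exact BetaReduces.rfl' _
  | 0, _ :: _, h, _ => absurd h (by simp)
  | _ + 1, [], h, _ => absurd h (by simp)
  | q + 1, t :: ts, hlen, hcl => by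
    have ht : t.Closed := hcl t (by simp)
    refine (BetaReduces.single (redB_apps_lams ht q B ts)).trans' ?_
    refine (apps_lams_betaReduces _ q ts (by simpa using hlen) fun t' ht' => hcl t' (by simp [ht'])).trans' ?_
    rw [substp_substp, substp_congr (fun i => substAt_substp_instN ht i)]
    exact BetaReduces.rfl' _

/-- The generic `β`-lemma with trailing arguments. [folklore] -/
theorem apps_lams_betaReduces_append (B : Term) {q : ℕ} {ts : List Term} (hlen : ts.length = q)
    (hcl : ∀ t ∈ ts, t.Closed) (as : List Term) :
    BetaReduces ((lams q B).apps (ts ++ as)) ((B.substp (instN q ts)).apps as) := by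
  rw [apps_append]
  exact (apps_lams_betaReduces B q ts hlen hcl).apps_head as

/-! ### Selectors, pairs, chains -/

/-- The selectors `oneHot q i = λx₀…x_{q-1}. xᵢ` of `STAEncBasics.lean` are closed. [folklore] -/
theorem closed_oneHot {q i : ℕ} (hi : i < q) : (oneHot q i).Closed := by
  simp only [Closed, oneHot, bnd_lams, bnd_var, decide_eq_true_eq]; omega

/-- **Selection**: `oneHot q i t₀ ⋯ t_{q-1} →β* tᵢ` for closed arguments. [cite: GaboardiMarionRonchidellarocca2008, §3.2] -/
theorem apps_oneHot_betaReduces {q i : ℕ} (hi : i < q) {ts : List Term} (hlen : ts.length = q)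
    (hcl : ∀ t ∈ ts, t.Closed) : BetaReduces ((oneHot q i).apps ts) (ts.getD i (.var 0)) := by
  have := apps_lams_betaReduces (.var (q - 1 - i)) q ts hlen hcl
  simp only [Term.substp, instN_lt ts (show q - 1 - i < q by omega)] at this
  rwa [show q - 1 - (q - 1 - i) = i by omega] at this

/-- Selection with trailing arguments. [folklore] -/
theorem apps_oneHot_betaReduces_append {q i : ℕ} (hi : i < q) {ts : List Term} (hlen : ts.length = q)
    (hcl : ∀ t ∈ ts, t.Closed) (as : List Term) :
    BetaReduces ((oneHot q i).apps (ts ++ as)) ((ts.getD i (.var 0)).apps as) := by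
  rw [apps_append]
  exact (apps_oneHot_betaReduces hi hlen hcl).apps_head as

/-- The pairing combinator `PAIR = λxyk. k x y` (`⟨M, N⟩ = PAIR M N →β* λk. k M N`).
[cite: GaboardiMarionRonchidellarocca2008, §3.2] -/
def PAIR : Term := lams 3 ((Term.var 0).apps [.var 2, .var 1])

/-- `PAIR` is closed. [folklore] -/
theorem closed_PAIR : PAIR.Closed := by decide

/-- **Pairing**: `PAIR a b k a⃗ →β* k a b a⃗` for closed `a b k`. [cite: GaboardiMarionRonchidellarocca2008, §3.2] -/
theorem apps_PAIR_betaReduces {a b k : Term} (ha : a.Closed) (hb : b.Closed) (hk : k.Closed) (as : List Term) :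
    BetaReduces (PAIR.apps (a :: b :: k :: as)) (k.apps (a :: b :: as)) := by
  have := apps_lams_betaReduces_append ((Term.var 0).apps [.var 2, .var 1]) (q := 3) (ts := [a, b, k]) rfl
    (by simp [ha, hb, hk]) as
  simp only [substp_apps, List.map_cons, List.map_nil, Term.substp, instN, List.getD] at this
  exact this

/-- The chain `K v₀ (K v₁ (⋯ (K v_{k-1} Z)))` of a list. [cite: GaboardiMarionRonchidellarocca2008, §3.2] -/
def chain (K Z : Term) : List Term → Term
  | [] => Z
  | v :: vs => K.apps [v, chain K Z vs]

/-- Empty chain. [folklore] -/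
@[simp] theorem chain_nil (K Z : Term) : chain K Z [] = Z := rfl

/-- One more link. [folklore] -/
@[simp] theorem chain_cons (K Z v : Term) (vs : List Term) : chain K Z (v :: vs) = K.apps [v, chain K Z vs] := rfl

/-- Substitution through a chain of closed elements. [folklore] -/
theorem chain_substp (K Z : Term) {vs : List Term} (hvs : ∀ v ∈ vs, v.Closed) (τ : ℕ → Term) :
    (chain K Z vs).substp τ = chain (K.substp τ) (Z.substp τ) vs := by
  induction vs with
  | nil => rfl
  | cons v vs ih =>
    simp only [chain_cons, substp_apps, List.map_cons, List.map_nil, (hvs v (by simp)).substp_eq]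
    rw [ih fun w hw => hvs w (by simp [hw])]

/-- A chain of closed parts is closed. [folklore] -/
theorem closed_chain {K Z : Term} (hK : K.Closed) (hZ : Z.Closed) {vs : List Term} (hvs : ∀ v ∈ vs, v.Closed) :
    (chain K Z vs).Closed := by
  induction vs with
  | nil => exact hZ
  | cons v vs ih =>
    rw [chain_cons, closed_apps]
    exact ⟨hK, by simpa using ⟨hvs v (by simp), ih fun w hw => hvs w (by simp [hw])⟩⟩

/-- Bound of a chain. [folklore] -/
theorem bnd_chain {n : ℕ} {K Z : Term} (hK : K.bnd n = true) (hZ : Z.bnd n = true) {vs : List Term}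
    (hvs : ∀ v ∈ vs, v.Closed) : (chain K Z vs).bnd n = true := by
  induction vs with
  | nil => exact hZ
  | cons v vs ih =>
    rw [chain_cons]
    exact bnd_apps hK (by simpa using ⟨(hvs v (by simp)).bnd n, ih fun w hw => hvs w (by simp [hw])⟩)

/-- The Church list `λc.λz. c v₀ (c v₁ (⋯ (c v_{k-1} z)))` of closed elements; `encWord w` is the
case of bits. [cite: GaboardiMarionRonchidellarocca2008, §3.2] -/
def encList (vs : List Term) : Term := lams 2 (chain (.var 1) (.var 0) vs)

/-- Words are Church lists of bits. [cite: GaboardiMarionRonchidellarocca2008, §3.2] -/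
theorem encWord_eq_encList (w : List Bool) : encWord w = encList (w.map encBit) := by
  unfold encWord encList
  simp only [lams_succ, lams_zero, Term.lam.injEq]
  induction w with
  | nil => rfl
  | cons b w ih => simp [ih]

/-- Church lists of closed elements are closed. [folklore] -/
theorem closed_encList {vs : List Term} (hvs : ∀ v ∈ vs, v.Closed) : (encList vs).Closed := by
  simp only [Closed, encList, bnd_lams, Nat.zero_add]
  exact bnd_chain (by decide) (by decide) hvs

/-- Words are closed. [folklore] -/
theorem closed_encWord (w : List Bool) : (encWord w).Closed := by
  rw [encWord_eq_encList]
  exact closed_encList fun v hv => by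
    obtain ⟨b, -, rfl⟩ := List.mem_map.1 hv
    exact closed_encBit b

/-- **Folding a Church list**: `encList v⃗ K Z a⃗ →β* (K v₀ (⋯ (K v_{k-1} Z))) a⃗` for closed
`K`, `Z`. [cite: GaboardiMarionRonchidellarocca2008, §3.2] -/
theorem apps_encList_betaReduces {vs : List Term} (hvs : ∀ v ∈ vs, v.Closed) {K Z : Term} (hK : K.Closed)
    (hZ : Z.Closed) (as : List Term) : BetaReduces ((encList vs).apps (K :: Z :: as)) ((chain K Z vs).apps as) := by
  have := apps_lams_betaReduces_append (chain (.var 1) (.var 0) vs) (q := 2) (ts := [K, Z]) rfl (by simp [hK, hZ]) as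
  rwa [chain_substp _ _ hvs] at this

end STA

end Literature.Computability.ImplicitComplexity
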